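import Literature.MathematicalPhysics.QuantumFieldTheory.YangMillsOS

/-!
# Crux `LatticeGapLargeBeta` (route `EquipartitionCriticality`), line `Sketch` = card
`af-staircase-transport`: stub `stub_iterate` — climbing the staircase

Supports statement item stmt-QuantumFields-8761
(`Summit.QuantumFields.YangMills.Theses.EquipartitionCriticality.LatticeGapLargeBeta`), line
`Sketch` (asymptotic-freedom staircase), stub I = `stub_iterate` of the lead's registered skeleton.

Content.  In the currency of the line,

  SC(β, S, m, K) :≡ for all species `A, B` with sup bounds `a, b` and supports in the time slab
    `|t| ≤ w`, and all `n ≤ S`: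
    `|latticeConnectedCorr r.ρ β (2S+1) A.F B.F n| ≤ K a b e^{2mw} e^{−mn}`,

the stub says: the staircase (for all `β ≥ 0`, `0 < δ ≤ Δβ`, `S ≥ L₀ β`, `0 < m ≤ 1`, `K ≥ 2`:
SC(β, S, m, K) ⇒ SC(β+δ, 2S, θm, cK) ∧ SC(β+δ, 2S+1, θm, cK)) together with the anchor
SC(0, S, 1, 2) for every `S` give, for every `β ≥ 0`, constants `m ∈ (0, 1]`, `K ≥ 2`, `S₀` with
SC(β, S, m, K) for all `S ≥ S₀`.

This is pure logic plus elementary real arithmetic: nothing about the Wilson measure is used.  It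
is first proved for an ARBITRARY predicate `P : ℝ → ℕ → ℝ → ℝ → Prop` (`iterate_abstract`), by
induction on `k` under `β ≤ k Δβ`: for `0 < β ≤ (k+1) Δβ` apply the step at
`β' = β k/(k+1) ≤ k Δβ` with `δ = β/(k+1) ≤ Δβ` and half-side `T`, `S = 2T` or `S = 2T+1`, for
`S ≥ 2 (S₀(β') + L₀(β'))`; the new rate is `θ m'`, the new prefactor `c K'`.  Then
`k := ⌈β/Δβ⌉₊`, and finally `P` is instantiated with the SC block.

Not here: the staircase itself (the heart of the line), the anchor at `β = 0`, rate dilution, the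
passage to the crux body — these are the other stubs of the skeleton.
-/

noncomputable section

open scoped BigOperators Topology
open MeasureTheory ProbabilityTheory Filter
open Literature.MathematicalPhysics.QuantumFieldTheory Literature.MathematicalPhysics.QuantumLattice

namespace Summit.QuantumFields.YangMills.Theorems.LatticeGapLargeBeta.AfStaircase

/-- **Abstract staircase iteration, bounded number of steps.**  For an arbitrary predicate
`P β S m K` ("clustering at coupling `β` on the torus of half-side `S` with rate `m` and prefactor
`K`"): if one step raises the coupling by any `δ ∈ (0, Δβ]` while doubling the half-side (to `2S`
and to `2S+1`) at the cost `m ↦ θ m`, `K ↦ c K` (`0 < θ ≤ 1 ≤ c`), for `S ≥ L₀ β`, `0 < m ≤ 1`,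
`K ≥ 2`, and if `P 0 S 1 2` holds for every `S`, then for every `k : ℕ` and every `β ∈ [0, k Δβ]`
there are `m ∈ (0, 1]`, `K ≥ 2`, `S₀` with `P β S m K` for all `S ≥ S₀`.  Induction on `k`;
the step splits `β = β' + δ`, `β' = β k/(k+1)`, `δ = β/(k+1)`, and halves the side. [folklore] -/
private theorem iterate_abstract_le {P : ℝ → ℕ → ℝ → ℝ → Prop} {Δβ θ c : ℝ} {L₀ : ℝ → ℕ}
    (hθ : 0 < θ) (hθ1 : θ ≤ 1) (hc : 1 ≤ c)
    (hstep : ∀ β : ℝ, 0 ≤ β → ∀ δ : ℝ, 0 < δ → δ ≤ Δβ → ∀ S : ℕ, L₀ β ≤ S →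
      ∀ m K : ℝ, 0 < m → m ≤ 1 → 2 ≤ K → P β S m K →
        P (β + δ) (2 * S) (θ * m) (c * K) ∧ P (β + δ) (2 * S + 1) (θ * m) (c * K))
    (hanch : ∀ S : ℕ, P 0 S 1 2) :
    ∀ (k : ℕ) (β : ℝ), 0 ≤ β → β ≤ k * Δβ →
      ∃ (m K : ℝ) (S₀ : ℕ), 0 < m ∧ m ≤ 1 ∧ 2 ≤ K ∧ ∀ S : ℕ, S₀ ≤ S → P β S m K := by
  intro k
  induction k with
  | zero =>
    intro β hβ hβk
    obtain rfl : β = 0 := le_antisymm (by simpa using hβk) hβ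
    exact ⟨1, 2, 0, one_pos, le_rfl, le_rfl, fun S _ => hanch S⟩
  | succ k ih =>
    intro β hβ hβk
    push_cast at hβk
    rcases hβ.eq_or_lt with rfl | hβpos
    · exact ⟨1, 2, 0, one_pos, le_rfl, le_rfl, fun S _ => hanch S⟩
    have hk0 : (0 : ℝ) ≤ k := Nat.cast_nonneg k
    have hk1 : (0 : ℝ) < k + 1 := by positivity
    -- split `β = β' + δ` with `β' = β k/(k+1) ∈ [0, k Δβ]` and `δ = β/(k+1) ∈ (0, Δβ]`
    obtain ⟨β', hβ'0, hβ'k, δ, hδ0, hδ, rfl⟩ :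
        ∃ β' : ℝ, 0 ≤ β' ∧ β' ≤ k * Δβ ∧ ∃ δ : ℝ, 0 < δ ∧ δ ≤ Δβ ∧ β' + δ = β := by
      refine ⟨β * k / (k + 1), div_nonneg (mul_nonneg hβ hk0) hk1.le, ?_, β / (k + 1),
        div_pos hβpos hk1, ?_, ?_⟩
      · rw [div_le_iff₀ hk1]
        calc β * k ≤ (k + 1) * Δβ * k := mul_le_mul_of_nonneg_right hβk hk0
          _ = k * Δβ * (k + 1) := by ring
      · rw [div_le_iff₀ hk1]
        exact hβk.trans_eq (mul_comm _ _)
      · rw [← add_div, div_eq_iff hk1.ne']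
        ring
    obtain ⟨m', K', S₀', hm', hm'1, hK', hP⟩ := ih β' hβ'0 hβ'k
    refine ⟨θ * m', c * K', 2 * (S₀' + L₀ β'), mul_pos hθ hm', mul_le_one₀ hθ1 hm'.le hm'1,
      hK'.trans (le_mul_of_one_le_left (zero_le_two.trans hK') hc), fun S hS => ?_⟩
    -- halve the side: `S = 2T` or `S = 2T + 1` with `T ≥ S₀'` and `T ≥ L₀ β'`
    obtain ⟨T, rfl | rfl⟩ := Nat.even_or_odd' S
    · exact (hstep β' hβ'0 δ hδ0 hδ T (by omega) m' K' hm' hm'1 hK' (hP T (by omega))).1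
    · exact (hstep β' hβ'0 δ hδ0 hδ T (by omega) m' K' hm' hm'1 hK' (hP T (by omega))).2

/-- **Abstract staircase iteration.**  As `iterate_abstract_le`, for every `β ≥ 0`: take
`k = ⌈β/Δβ⌉₊` steps (`β ≤ ⌈β/Δβ⌉₊ Δβ` as `Δβ > 0`). [folklore] -/
private theorem iterate_abstract {P : ℝ → ℕ → ℝ → ℝ → Prop} {Δβ θ c : ℝ} {L₀ : ℝ → ℕ}
    (hΔ : 0 < Δβ) (hθ : 0 < θ) (hθ1 : θ ≤ 1) (hc : 1 ≤ c)
    (hstep : ∀ β : ℝ, 0 ≤ β → ∀ δ : ℝ, 0 < δ → δ ≤ Δβ → ∀ S : ℕ, L₀ β ≤ S →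
      ∀ m K : ℝ, 0 < m → m ≤ 1 → 2 ≤ K → P β S m K →
        P (β + δ) (2 * S) (θ * m) (c * K) ∧ P (β + δ) (2 * S + 1) (θ * m) (c * K))
    (hanch : ∀ S : ℕ, P 0 S 1 2) :
    ∀ β : ℝ, 0 ≤ β →
      ∃ (m K : ℝ) (S₀ : ℕ), 0 < m ∧ m ≤ 1 ∧ 2 ≤ K ∧ ∀ S : ℕ, S₀ ≤ S → P β S m K :=
  fun β hβ => iterate_abstract_le hθ hθ1 hc hstep hanch ⌈β / Δβ⌉₊ β hβ
    ((div_le_iff₀ hΔ).1 (Nat.le_ceil _))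

/-- `stub_iterate` — **climbing the staircase** (stub I of line `Sketch`, card
`af-staircase-transport`, crux `LatticeGapLargeBeta`).  From the staircase (hypothesis, the shape of
`stub_staircase`'s conclusion for `r`: there are `Δβ > 0`, `θ ∈ (0, 1]`, `c ≥ 1`, `L₀` such that
for all `β ≥ 0`, `0 < δ ≤ Δβ`, `S ≥ L₀ β`, `0 < m ≤ 1`, `K ≥ 2`,
SC(β, S, m, K) ⇒ SC(β+δ, 2S, θm, cK) ∧ SC(β+δ, 2S+1, θm, cK)) and the anchor SC(0, S, 1, 2) for all
`S` (the shape of `stub_anchorZero`'s conclusion for `r`): for every `β ≥ 0` there are `m ∈ (0, 1]`,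
`K ≥ 2` and `S₀` with SC(β, S, m, K) for all `S ≥ S₀`.  Here SC(β, S, m, K) is the inlined block
"for all species `A, B` bounded by `a, b` with supports in the time slab `|t| ≤ w` and all `n ≤ S`,
`|latticeConnectedCorr r.ρ β (2S+1) A.F B.F n| ≤ K a b e^{2mw} e^{−mn}`".  Proof: `iterate_abstract`
with `P β S m K :=` SC(β, S, m, K). [folklore] -/
theorem stub_iterate :
    ∀ (G : Type) [Group G] [TopologicalSpace G] [IsTopologicalGroup G] [CompactSpace G]
      [MeasurableSpace G] [BorelSpace G] (r : LatticeRep G),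
    (∃ (Δβ θ c : ℝ) (L₀ : ℝ → ℕ), 0 < Δβ ∧ 0 < θ ∧ θ ≤ 1 ∧ 1 ≤ c ∧
      ∀ β : ℝ, 0 ≤ β → ∀ δ : ℝ, 0 < δ → δ ≤ Δβ → ∀ S : ℕ, L₀ β ≤ S →
      ∀ m K : ℝ, 0 < m → m ≤ 1 → 2 ≤ K →
        (∀ (A B : YMSpecies G) (a b : ℝ) (w : ℕ), (∀ U, |A.F U| ≤ a) → (∀ U, |B.F U| ≤ b) →
          (∀ e ∈ A.supp, |e.1 0| ≤ (w : ℤ)) → (∀ e ∈ B.supp, |e.1 0| ≤ (w : ℤ)) →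
          ∀ n : ℕ, n ≤ S →
            |latticeConnectedCorr r.ρ β (2 * S + 1) A.F B.F n| ≤
              K * a * b * Real.exp (m * (2 * w)) * Real.exp (-(m * n))) →
        (∀ (A B : YMSpecies G) (a b : ℝ) (w : ℕ), (∀ U, |A.F U| ≤ a) → (∀ U, |B.F U| ≤ b) →
          (∀ e ∈ A.supp, |e.1 0| ≤ (w : ℤ)) → (∀ e ∈ B.supp, |e.1 0| ≤ (w : ℤ)) →
          ∀ n : ℕ, n ≤ 2 * S →
            |latticeConnectedCorr r.ρ (β + δ) (2 * (2 * S) + 1) A.F B.F n| ≤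
              c * K * a * b * Real.exp (θ * m * (2 * w)) * Real.exp (-(θ * m * n))) ∧
        (∀ (A B : YMSpecies G) (a b : ℝ) (w : ℕ), (∀ U, |A.F U| ≤ a) → (∀ U, |B.F U| ≤ b) →
          (∀ e ∈ A.supp, |e.1 0| ≤ (w : ℤ)) → (∀ e ∈ B.supp, |e.1 0| ≤ (w : ℤ)) →
          ∀ n : ℕ, n ≤ 2 * S + 1 →
            |latticeConnectedCorr r.ρ (β + δ) (2 * (2 * S + 1) + 1) A.F B.F n| ≤
              c * K * a * b * Real.exp (θ * m * (2 * w)) * Real.exp (-(θ * m * n)))) →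
    (∀ (S : ℕ) (A B : YMSpecies G) (a b : ℝ) (w : ℕ), (∀ U, |A.F U| ≤ a) → (∀ U, |B.F U| ≤ b) →
      (∀ e ∈ A.supp, |e.1 0| ≤ (w : ℤ)) → (∀ e ∈ B.supp, |e.1 0| ≤ (w : ℤ)) →
      ∀ n : ℕ, n ≤ S →
        |latticeConnectedCorr r.ρ 0 (2 * S + 1) A.F B.F n| ≤
          2 * a * b * Real.exp (1 * (2 * w)) * Real.exp (-(1 * n))) →
    ∀ β : ℝ, 0 ≤ β → ∃ (m K : ℝ) (S₀ : ℕ), 0 < m ∧ m ≤ 1 ∧ 2 ≤ K ∧ ∀ S : ℕ, S₀ ≤ S →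
      ∀ (A B : YMSpecies G) (a b : ℝ) (w : ℕ), (∀ U, |A.F U| ≤ a) → (∀ U, |B.F U| ≤ b) →
        (∀ e ∈ A.supp, |e.1 0| ≤ (w : ℤ)) → (∀ e ∈ B.supp, |e.1 0| ≤ (w : ℤ)) →
        ∀ n : ℕ, n ≤ S →
          |latticeConnectedCorr r.ρ β (2 * S + 1) A.F B.F n| ≤
            K * a * b * Real.exp (m * (2 * w)) * Real.exp (-(m * n)) := by
  intro G _ _ _ _ _ _ r hH hA
  obtain ⟨Δβ, θ, c, L₀, hΔ, hθ, hθ1, hc, hstep⟩ := hH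
  exact iterate_abstract (L₀ := L₀)
    (P := fun β S m K => ∀ (A B : YMSpecies G) (a b : ℝ) (w : ℕ), (∀ U, |A.F U| ≤ a) →
      (∀ U, |B.F U| ≤ b) → (∀ e ∈ A.supp, |e.1 0| ≤ (w : ℤ)) →
      (∀ e ∈ B.supp, |e.1 0| ≤ (w : ℤ)) → ∀ n : ℕ, n ≤ S →
        |latticeConnectedCorr r.ρ β (2 * S + 1) A.F B.F n| ≤
          K * a * b * Real.exp (m * (2 * w)) * Real.exp (-(m * n)))
    hΔ hθ hθ1 hc hstep hA

end Summit.QuantumFields.YangMills.Theorems.LatticeGapLargeBeta.AfStaircase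

end
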